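import Mathlib
import HarnessLib

/-!
# The gcd form of a resonator and its factorisation over the primes ([CV] Lemma 3.2)

For a finitely supported "resonator" `α : ℕ → ℂ` (supported on `1 ≤ ℓ ≤ L`) the **gcd form** at the
integer `n` is

  `Φ_α(n) = ∑_{ℓ, ℓ' ≤ L} α(ℓ) conj(α(ℓ')) · gcd(n ℓ', ℓ) / √(ℓ ℓ')`.

It is the profile through which the class sums `∑ₙ (c(n) − Λ(n))/n · Re Φ_α(n)` of a weight `c` are
tested in the zero-forcing resonator method of the 2001 programme (archive `2001`, summit
`rh-w-composite-vanishing`, free seat `y1`, paper "Weil positivity forces a non-negative integer-supported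
prime measure onto the prime powers", §3, Lemma 3.2: "the profile of a product resonator is the product of
its local profiles"; the same calculus is used in `rh-w-magnification/free/y1` §5 and in
`summits/rh/routes/slack-weil-cone-magnification/paper/paper.tex` §3, Remark 3.6). These internal
preprints are unpublished; everything in this file is PROVED, so the statements are tagged `[folklore]`
(elementary multiplicative number theory) with the archive locator given for orientation only.

## Contents

* `gcdForm α L n` — the gcd form, written with EXACTLY the expression used by the crux line of
  `Summits/RiemannHypothesis/RiemannHypothesis/Cruxes/ConeMagnification/Lines/Sketch.lean`
  (stubs `stub_combType`, `stub_designOfTypes`), so that those statements are instances by `rfl`.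
* `gcdKernel n ℓ ℓ' = gcd(n ℓ', ℓ)/√(ℓ ℓ')` and `gcdForm_eq_sum_kernel`.
* `locKernel p k i j = p^{min(k+j, i)} / (√p)^{i+j}` — the kernel at `ℓ = pⁱ`, `ℓ' = pʲ`, `v_p(n) = k` —
  and the COPRIME FACTORISATION `gcdKernel_primePow_mul` of the kernel.
* `locProfile p m v k = ∑_{i,j ≤ m} v i · conj(v j) · locKernel p k i j` — the local profile of a local
  vector `v` supported on `{1, p, …, p^m}`.
* `prodResonator S m β` — the product resonator `α(∏ p^{i_p}) = ∏_{p ∈ S} β p i_p` supported on the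
  divisors of `∏_{p∈S} p^m` (`S` a finite set of primes, `β p` the local vector at `p`).
* `gcdForm_prodResonator` (**[CV] Lemma 3.2**): for `n ≠ 0` and `L ≥ ∏_{p∈S} p^m`,
  `Φ_{α}(n) = ∏_{p ∈ S} locProfile p m (β p) (v_p(n))`.

Design choices: `L` is an explicit truncation parameter (the crux statements quantify `α` vanishing above
`L`); the product resonator is defined non-recursively through `Nat.divisors`, and the factorisation is
proved by induction on `S` using `Nat.divisors_mul` and `Nat.Coprime.mul_injOn_divisors`.
NOT here: any analytic statement (the type inequality itself), and the specific local vectors of the 2001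
designs (two-term, three-term, Riesz–Euler), which live in the files that use them.
-/

noncomputable section

open Finset
open scoped BigOperators ComplexConjugate

namespace Literature.NumberTheory.LFunctions

namespace GcdForm

/-! ### The gcd form and its kernel -/

/-- The **gcd form** of a resonator `α` truncated at `L`, at the integer `n`:
`Φ_α(n) = ∑_{1 ≤ ℓ, ℓ' ≤ L} α(ℓ) conj(α(ℓ')) gcd(n ℓ', ℓ)/√(ℓ ℓ')` (written with the literal expression of
the crux line `ConeMagnification/Lines/Sketch.lean`). [folklore] -/
def gcdForm (α : ℕ → ℂ) (L : ℕ) (n : ℕ) : ℂ :=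
  ∑ ℓ ∈ Finset.Icc 1 L, ∑ ℓ' ∈ Finset.Icc 1 L, α ℓ * (starRingEnd ℂ) (α ℓ') *
    (((Nat.gcd (n * ℓ') ℓ : ℕ) : ℝ) : ℂ) / (Real.sqrt ((ℓ : ℝ) * ℓ') : ℂ)

/-- The pair kernel `K_n(ℓ, ℓ') = gcd(n ℓ', ℓ)/√(ℓ ℓ')` of the gcd form. [folklore] -/
def gcdKernel (n ℓ ℓ' : ℕ) : ℂ :=
  (((Nat.gcd (n * ℓ') ℓ : ℕ) : ℝ) : ℂ) / (Real.sqrt ((ℓ : ℝ) * ℓ') : ℂ)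

/-- The gcd form is the hermitian form `∑ α(ℓ) conj(α(ℓ')) K_n(ℓ, ℓ')`. [folklore] -/
theorem gcdForm_eq_sum_kernel (α : ℕ → ℂ) (L n : ℕ) :
    gcdForm α L n = ∑ ℓ ∈ Finset.Icc 1 L, ∑ ℓ' ∈ Finset.Icc 1 L,
      α ℓ * conj (α ℓ') * gcdKernel n ℓ ℓ' := by
  unfold gcdForm gcdKernel
  refine Finset.sum_congr rfl fun ℓ _ => Finset.sum_congr rfl fun ℓ' _ => ?_
  rw [mul_div_assoc]

/-- The local kernel at a prime `p`: the value of `K_n(pⁱ, pʲ)` when `v_p(n) = k`, namely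
`p^{min(k+j, i)}/(√p)^{i+j}`. [folklore] -/
def locKernel (p k i j : ℕ) : ℂ :=
  (((p : ℝ) ^ (min (k + j) i)) : ℂ) / ((Real.sqrt p : ℂ) ^ (i + j))

/-- The **local profile** of a local vector `v` (supported on the exponents `0, …, m`) at the prime `p` and
the valuation `k`: `∑_{i, j ≤ m} v(i) conj(v(j)) p^{min(k+j,i)}/(√p)^{i+j}`. [folklore] -/
def locProfile (p m : ℕ) (v : ℕ → ℂ) (k : ℕ) : ℂ :=
  ∑ i ∈ Finset.range (m + 1), ∑ j ∈ Finset.range (m + 1), v i * conj (v j) * locKernel p k i j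

/-! ### The kernel at the trivial pair and its coprime factorisation -/

/-- `K_n(1, 1) = 1`. [folklore] -/
theorem gcdKernel_one_one (n : ℕ) : gcdKernel n 1 1 = 1 := by
  simp [gcdKernel]

/-- `gcd(N pʲ, pⁱ) = p^{min(v_p(N) + j, i)}` for `N ≠ 0`. [folklore] -/
theorem gcd_mul_prime_pow_prime_pow {p : ℕ} (hp : p.Prime) {N : ℕ} (hN : N ≠ 0) (i j : ℕ) :
    Nat.gcd (N * p ^ j) (p ^ i) = p ^ min (N.factorization p + j) i := by
  have hNp : N * p ^ j ≠ 0 := mul_ne_zero hN (pow_ne_zero _ hp.pos.ne')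
  have hpi : p ^ i ≠ 0 := pow_ne_zero _ hp.pos.ne'
  obtain ⟨k, -, hk⟩ := (Nat.dvd_prime_pow hp).mp (Nat.gcd_dvd_right (N * p ^ j) (p ^ i))
  have hfact : (Nat.gcd (N * p ^ j) (p ^ i)).factorization p = min (N.factorization p + j) i := by
    rw [Nat.factorization_gcd hNp hpi, Finsupp.inf_apply, Nat.factorization_mul hN (pow_ne_zero _ hp.pos.ne'),
      Finsupp.add_apply, hp.factorization_pow, Finsupp.single_eq_same, hp.factorization_pow,
      Finsupp.single_eq_same]
  rw [hk, hp.factorization_pow, Finsupp.single_eq_same] at hfact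
  rw [hk, hfact]

/-- **Coprime factorisation of the kernel**: if `p` is a prime not dividing `ℓ₀`, `ℓ₀'`, and `n ≠ 0`, then
`K_n(pⁱ ℓ₀, pʲ ℓ₀') = locKernel p (v_p n) i j · K_n(ℓ₀, ℓ₀')`. [folklore] -/
theorem gcdKernel_primePow_mul {p : ℕ} (hp : p.Prime) {n ℓ₀ ℓ₀' : ℕ} (hn : n ≠ 0) (hℓ₀ : ¬ p ∣ ℓ₀)
    (hℓ₀' : ¬ p ∣ ℓ₀') (i j : ℕ) :
    gcdKernel n (p ^ i * ℓ₀) (p ^ j * ℓ₀') = locKernel p (n.factorization p) i j * gcdKernel n ℓ₀ ℓ₀' := by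
  unfold gcdKernel locKernel
  -- the gcd factorises
  have hcop : Nat.Coprime (p ^ i) ℓ₀ := Nat.Coprime.pow_left i ((Nat.Prime.coprime_iff_not_dvd hp).2 hℓ₀)
  have hcop' : Nat.Coprime (p ^ j) ℓ₀ := Nat.Coprime.pow_left j ((Nat.Prime.coprime_iff_not_dvd hp).2 hℓ₀)
  have hgcd : Nat.gcd (n * (p ^ j * ℓ₀')) (p ^ i * ℓ₀) =
      p ^ min (n.factorization p + j) i * Nat.gcd (n * ℓ₀') ℓ₀ := by
    rw [Nat.Coprime.gcd_mul _ hcop]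
    congr 1
    · rw [show n * (p ^ j * ℓ₀') = (n * ℓ₀') * p ^ j by ring]
      rcases Nat.eq_zero_or_pos ℓ₀' with h0 | hpos
      · subst h0
        exact absurd (dvd_zero p) hℓ₀'
      · rw [gcd_mul_prime_pow_prime_pow hp (mul_ne_zero hn hpos.ne') i j,
          Nat.factorization_mul hn hpos.ne', Finsupp.add_apply,
          Nat.factorization_eq_zero_of_not_dvd hℓ₀', add_zero]
    · rw [show n * (p ^ j * ℓ₀') = p ^ j * (n * ℓ₀') by ring]
      exact Nat.Coprime.gcd_mul_left_cancel _ hcop'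
  rw [hgcd]
  -- the square root factorises
  have hp0 : (0 : ℝ) ≤ p := Nat.cast_nonneg p
  have hsqrt : Real.sqrt (((p ^ i * ℓ₀ : ℕ) : ℝ) * ((p ^ j * ℓ₀' : ℕ) : ℝ)) =
      Real.sqrt p ^ (i + j) * Real.sqrt ((ℓ₀ : ℝ) * ℓ₀') := by
    have h1 : ((p ^ i * ℓ₀ : ℕ) : ℝ) * ((p ^ j * ℓ₀' : ℕ) : ℝ) =
        ((p : ℝ) ^ (i + j)) * ((ℓ₀ : ℝ) * ℓ₀') := by
      push_cast
      ring
    -- `√(p^(i+j)) = (√p)^(i+j)` (this is `Literature.NumberTheory.Automorphic.real_sqrt_pow`, inlined to keep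
    -- the import graph of this elementary file small)
    have hsp : Real.sqrt ((p : ℝ) ^ (i + j)) = Real.sqrt p ^ (i + j) := by
      rw [show (p : ℝ) ^ (i + j) = (Real.sqrt p ^ (i + j)) ^ 2 by
          rw [← pow_mul, mul_comm, pow_mul, Real.sq_sqrt hp0],
        Real.sqrt_sq (pow_nonneg (Real.sqrt_nonneg _) _)]
    rw [h1, Real.sqrt_mul (by positivity), hsp]
  rw [hsqrt]
  push_cast
  ring

/-! ### The product resonator and its support -/

/-- The modulus `N_S = ∏_{p ∈ S} p^m` whose divisors carry the product resonator. [folklore] -/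
def smoothModulus (S : Finset ℕ) (m : ℕ) : ℕ := ∏ p ∈ S, p ^ m

/-- The **product resonator** with local vectors `β p : ℕ → ℂ` (`p ∈ S`) at levels `≤ m`:
`α(ℓ) = ∏_{p∈S} β p (v_p ℓ)` if `ℓ` divides `N_S = ∏_{p∈S} p^m`, and `0` otherwise. [folklore] -/
def prodResonator (S : Finset ℕ) (m : ℕ) (β : ℕ → ℕ → ℂ) (ℓ : ℕ) : ℂ :=
  if ℓ ∈ (smoothModulus S m).divisors then ∏ p ∈ S, β p (ℓ.factorization p) else 0

/-- `N_S ≠ 0` for a set of primes. [folklore] -/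
theorem smoothModulus_ne_zero {S : Finset ℕ} (hS : ∀ p ∈ S, p.Prime) (m : ℕ) : smoothModulus S m ≠ 0 :=
  Finset.prod_ne_zero_iff.2 fun p hp => pow_ne_zero _ (hS p hp).ne_zero

/-- `N_∅ = 1`. [folklore] -/
theorem smoothModulus_empty (m : ℕ) : smoothModulus ∅ m = 1 := by
  simp [smoothModulus]

/-- `N_{insert p S} = p^m · N_S` for `p ∉ S`. [folklore] -/
theorem smoothModulus_insert {S : Finset ℕ} {p : ℕ} (hp : p ∉ S) (m : ℕ) :
    smoothModulus (insert p S) m = p ^ m * smoothModulus S m := by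
  simp [smoothModulus, Finset.prod_insert hp]

/-- The product resonator vanishes off the divisors of `N_S`. [folklore] -/
theorem prodResonator_eq_zero_of_not_mem {S : Finset ℕ} {m : ℕ} (β : ℕ → ℕ → ℂ) {ℓ : ℕ}
    (h : ℓ ∉ (smoothModulus S m).divisors) : prodResonator S m β ℓ = 0 := by
  simp [prodResonator, h]

/-- On the divisors of `N_S` the product resonator is the product of the local coefficients. [folklore] -/
theorem prodResonator_of_mem {S : Finset ℕ} {m : ℕ} (β : ℕ → ℕ → ℂ) {ℓ : ℕ}
    (h : ℓ ∈ (smoothModulus S m).divisors) : prodResonator S m β ℓ = ∏ p ∈ S, β p (ℓ.factorization p) := by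
  simp [prodResonator, h]

/-- The product resonator vanishes above `N_S`. [folklore] -/
theorem prodResonator_eq_zero_of_lt {S : Finset ℕ} {m : ℕ} (β : ℕ → ℕ → ℂ) {ℓ : ℕ}
    (h : smoothModulus S m < ℓ) : prodResonator S m β ℓ = 0 := by
  apply prodResonator_eq_zero_of_not_mem
  intro hmem
  exact absurd (Nat.divisor_le hmem) (not_le.2 h)

/-- On the empty set of primes the product resonator is the indicator of `ℓ = 1`. [folklore] -/
theorem prodResonator_empty (m : ℕ) (β : ℕ → ℕ → ℂ) (ℓ : ℕ) :
    prodResonator ∅ m β ℓ = if ℓ = 1 then 1 else 0 := by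
  simp [prodResonator, smoothModulus]

/-- Inserting a new prime: on `pⁱ ℓ₀` (`i ≤ m`, `ℓ₀ ∣ N_S`) the product resonator of `insert p S` is
`β p i` times the product resonator of `S`. [folklore] -/
theorem prodResonator_insert {S : Finset ℕ} (hS : ∀ q ∈ S, q.Prime) {p : ℕ} (hp : p.Prime) (hpS : p ∉ S)
    {m : ℕ} (β : ℕ → ℕ → ℂ) {i : ℕ} (hi : i ≤ m) {ℓ₀ : ℕ} (hℓ₀ : ℓ₀ ∈ (smoothModulus S m).divisors) :
    prodResonator (insert p S) m β (p ^ i * ℓ₀) = β p i * prodResonator S m β ℓ₀ := by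
  have hN : smoothModulus S m ≠ 0 := smoothModulus_ne_zero hS m
  have hℓ₀0 : ℓ₀ ≠ 0 := Nat.ne_of_gt (Nat.pos_of_mem_divisors hℓ₀)
  -- `p` does not divide `ℓ₀` (all prime factors of `N_S` lie in `S`)
  have hpN : ¬ p ∣ smoothModulus S m := by
    intro hdvd
    unfold smoothModulus at hdvd
    obtain ⟨q, hq, hpq⟩ := (Prime.dvd_finsetProd_iff hp.prime _).1 hdvd
    have : p = q := (Nat.prime_dvd_prime_iff_eq hp (hS q hq)).1 (hp.dvd_of_dvd_pow hpq)
    exact hpS (this ▸ hq)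
  have hpℓ₀ : ¬ p ∣ ℓ₀ := fun h => hpN (h.trans (Nat.dvd_of_mem_divisors hℓ₀))
  have hmem : p ^ i * ℓ₀ ∈ (smoothModulus (insert p S) m).divisors := by
    rw [smoothModulus_insert hpS, Nat.mem_divisors]
    refine ⟨mul_dvd_mul (pow_dvd_pow p hi) (Nat.dvd_of_mem_divisors hℓ₀), ?_⟩
    exact mul_ne_zero (pow_ne_zero _ hp.ne_zero) hN
  rw [prodResonator_of_mem β hmem, prodResonator_of_mem β hℓ₀, Finset.prod_insert hpS]
  have hfac : (p ^ i * ℓ₀).factorization = Finsupp.single p i + ℓ₀.factorization := by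
    rw [Nat.factorization_mul (pow_ne_zero _ hp.ne_zero) hℓ₀0, hp.factorization_pow]
  congr 1
  · rw [hfac, Finsupp.add_apply, Finsupp.single_eq_same, Nat.factorization_eq_zero_of_not_dvd hpℓ₀, add_zero]
  · refine Finset.prod_congr rfl fun q hq => ?_
    have hqp : q ≠ p := fun h => hpS (h ▸ hq)
    rw [hfac, Finsupp.add_apply, Finsupp.single_eq_of_ne hqp, zero_add]

/-! ### Reindexing sums over the support -/

/-- A sum over `1 ≤ ℓ ≤ L` of a function vanishing off the divisors of `N ≤ L` is the sum over those
divisors. [folklore] -/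
theorem sum_Icc_eq_sum_divisors {N L : ℕ} (hNL : N ≤ L) (F : ℕ → ℂ)
    (hF : ∀ ℓ, ℓ ∉ N.divisors → F ℓ = 0) :
    ∑ ℓ ∈ Finset.Icc 1 L, F ℓ = ∑ ℓ ∈ N.divisors, F ℓ := by
  symm
  apply Finset.sum_subset
  · intro ℓ hℓ
    rw [Finset.mem_Icc]
    exact ⟨Nat.pos_of_mem_divisors hℓ, (Nat.divisor_le hℓ).trans hNL⟩
  · intro ℓ _ hℓ
    exact hF ℓ hℓ

/-- Divisors of `p^m · N` (`p ∤ N`) are the `pⁱ ℓ₀`, `i ≤ m`, `ℓ₀ ∣ N`, each exactly once. [folklore] -/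
theorem sum_divisors_primePow_mul {p : ℕ} (hp : p.Prime) {N : ℕ} (hpN : ¬ p ∣ N) (m : ℕ)
    (G : ℕ → ℂ) :
    ∑ ℓ ∈ (p ^ m * N).divisors, G ℓ = ∑ i ∈ Finset.range (m + 1), ∑ ℓ₀ ∈ N.divisors, G (p ^ i * ℓ₀) := by
  have hcop : (p ^ m).Coprime N := Nat.Coprime.pow_left m ((Nat.Prime.coprime_iff_not_dvd hp).2 hpN)
  rw [hcop.divisors_mul, Finset.sum_map]
  simp only [Function.Embedding.coeFn_mk]
  have h1 : ∑ x ∈ ((p ^ m).divisors ×ˢ N.divisors).attach, G (x.1.1 * x.1.2) =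
      ∑ x ∈ (p ^ m).divisors ×ˢ N.divisors, G (x.1 * x.2) :=
    Finset.sum_attach ((p ^ m).divisors ×ˢ N.divisors) (fun x => G (x.1 * x.2))
  refine h1.trans ?_
  rw [Finset.sum_product, Nat.divisors_prime_pow hp m, Finset.sum_map]
  rfl

/-- The kernel sum of the product resonator over its support. [folklore] -/
def kernelSum (S : Finset ℕ) (m : ℕ) (β : ℕ → ℕ → ℂ) (n : ℕ) : ℂ :=
  ∑ ℓ ∈ (smoothModulus S m).divisors, ∑ ℓ' ∈ (smoothModulus S m).divisors,
    prodResonator S m β ℓ * conj (prodResonator S m β ℓ') * gcdKernel n ℓ ℓ'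

/-- The gcd form of the product resonator (any truncation `L ≥ N_S`) is its kernel sum. [folklore] -/
theorem gcdForm_prodResonator_eq_kernelSum {S : Finset ℕ} (m : ℕ) (β : ℕ → ℕ → ℂ)
    {L : ℕ} (hL : smoothModulus S m ≤ L) (n : ℕ) :
    gcdForm (prodResonator S m β) L n = kernelSum S m β n := by
  rw [gcdForm_eq_sum_kernel]
  unfold kernelSum
  have hvan : ∀ ℓ, ℓ ∉ (smoothModulus S m).divisors → prodResonator S m β ℓ = 0 :=
    fun ℓ hℓ => prodResonator_eq_zero_of_not_mem β hℓ
  rw [sum_Icc_eq_sum_divisors hL _ (fun ℓ hℓ => by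
    simp only [hvan ℓ hℓ, zero_mul, Finset.sum_const_zero])]
  refine Finset.sum_congr rfl fun ℓ _ => ?_
  exact sum_Icc_eq_sum_divisors hL _ (fun ℓ' hℓ' => by simp only [hvan ℓ' hℓ', map_zero, mul_zero, zero_mul])

/-- The kernel sum on the empty set of primes is `1`. [folklore] -/
theorem kernelSum_empty (m : ℕ) (β : ℕ → ℕ → ℂ) (n : ℕ) : kernelSum ∅ m β n = 1 := by
  unfold kernelSum
  rw [smoothModulus_empty, Nat.divisors_one]
  simp [prodResonator_empty, gcdKernel_one_one]

/-- **Inductive step of [CV] Lemma 3.2**: inserting a prime multiplies the kernel sum by the local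
profile. [folklore] -/
theorem kernelSum_insert {S : Finset ℕ} (hS : ∀ q ∈ S, q.Prime) {p : ℕ} (hp : p.Prime) (hpS : p ∉ S)
    (m : ℕ) (β : ℕ → ℕ → ℂ) {n : ℕ} (hn : n ≠ 0) :
    kernelSum (insert p S) m β n = locProfile p m (β p) (n.factorization p) * kernelSum S m β n := by
  have hN : smoothModulus S m ≠ 0 := smoothModulus_ne_zero hS m
  have hpN : ¬ p ∣ smoothModulus S m := by
    intro hdvd
    unfold smoothModulus at hdvd
    obtain ⟨q, hq, hpq⟩ := (Prime.dvd_finsetProd_iff hp.prime _).1 hdvd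
    have : p = q := (Nat.prime_dvd_prime_iff_eq hp (hS q hq)).1 (hp.dvd_of_dvd_pow hpq)
    exact hpS (this ▸ hq)
  have hndvd : ∀ ℓ₀ ∈ (smoothModulus S m).divisors, ¬ p ∣ ℓ₀ :=
    fun ℓ₀ hℓ₀ h => hpN (h.trans (Nat.dvd_of_mem_divisors hℓ₀))
  unfold kernelSum
  rw [smoothModulus_insert hpS, sum_divisors_primePow_mul hp hpN m]
  conv_lhs =>
    arg 2; ext i; arg 2; ext ℓ₀
    rw [sum_divisors_primePow_mul hp hpN m]
  -- rewrite every summand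
  have hterm : ∀ i ∈ Finset.range (m + 1), ∀ ℓ₀ ∈ (smoothModulus S m).divisors,
      ∀ j ∈ Finset.range (m + 1), ∀ ℓ₀' ∈ (smoothModulus S m).divisors,
      prodResonator (insert p S) m β (p ^ i * ℓ₀) * conj (prodResonator (insert p S) m β (p ^ j * ℓ₀')) *
          gcdKernel n (p ^ i * ℓ₀) (p ^ j * ℓ₀') =
        (β p i * conj (β p j) * locKernel p (n.factorization p) i j) *
          (prodResonator S m β ℓ₀ * conj (prodResonator S m β ℓ₀') * gcdKernel n ℓ₀ ℓ₀') := by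
    intro i hi ℓ₀ hℓ₀ j hj ℓ₀' hℓ₀'
    rw [prodResonator_insert hS hp hpS β (Nat.lt_succ_iff.1 (Finset.mem_range.1 hi)) hℓ₀,
      prodResonator_insert hS hp hpS β (Nat.lt_succ_iff.1 (Finset.mem_range.1 hj)) hℓ₀',
      gcdKernel_primePow_mul hp hn (hndvd ℓ₀ hℓ₀) (hndvd ℓ₀' hℓ₀'), map_mul]
    ring
  rw [Finset.sum_congr rfl fun i hi => Finset.sum_congr rfl fun ℓ₀ hℓ₀ =>
    Finset.sum_congr rfl fun j hj => Finset.sum_congr rfl fun ℓ₀' hℓ₀' => hterm i hi ℓ₀ hℓ₀ j hj ℓ₀' hℓ₀']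
  -- factor the fourfold sum
  unfold locProfile
  rw [Finset.sum_mul_sum]
  refine Finset.sum_congr rfl fun i _ => Finset.sum_congr rfl fun ℓ₀ _ => ?_
  rw [Finset.sum_mul_sum]

/-- **[CV] Lemma 3.2 (kernel-sum form)**: for a finite set `S` of primes and `n ≠ 0`, the kernel sum of the
product resonator is the product over `p ∈ S` of the local profiles at the valuations `v_p(n)`.
[folklore] -/
theorem kernelSum_eq_prod_locProfile {S : Finset ℕ} (hS : ∀ p ∈ S, p.Prime) (m : ℕ) (β : ℕ → ℕ → ℂ)
    {n : ℕ} (hn : n ≠ 0) :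
    kernelSum S m β n = ∏ p ∈ S, locProfile p m (β p) (n.factorization p) := by
  induction S using Finset.induction_on with
  | empty => rw [kernelSum_empty, Finset.prod_empty]
  | @insert p S hpS ih =>
    have hS' : ∀ q ∈ S, q.Prime := fun q hq => hS q (Finset.mem_insert_of_mem hq)
    rw [kernelSum_insert hS' (hS p (Finset.mem_insert_self p S)) hpS m β hn, ih hS',
      Finset.prod_insert hpS]

/-- **[CV] Lemma 3.2**: the gcd form of a product resonator is the product of its local profiles:
for a finite set `S` of primes, local vectors `β p` at levels `≤ m`, any truncation `L ≥ ∏_{p∈S} p^m` and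
any `n ≠ 0`, `Φ_α(n) = ∏_{p∈S} locProfile p m (β p) (v_p n)` (archive 2001,
`rh-w-composite-vanishing/free/y1`, Lemma 3.2). [folklore] -/
theorem gcdForm_prodResonator {S : Finset ℕ} (hS : ∀ p ∈ S, p.Prime) (m : ℕ) (β : ℕ → ℕ → ℂ)
    {L : ℕ} (hL : smoothModulus S m ≤ L) {n : ℕ} (hn : n ≠ 0) :
    gcdForm (prodResonator S m β) L n = ∏ p ∈ S, locProfile p m (β p) (n.factorization p) := by
  rw [gcdForm_prodResonator_eq_kernelSum m β hL, kernelSum_eq_prod_locProfile hS m β hn]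

/-- At `n = 1` all valuations vanish: `Φ_α(1) = ∏_{p∈S} locProfile p m (β p) 0`. [folklore] -/
theorem gcdForm_prodResonator_one {S : Finset ℕ} (hS : ∀ p ∈ S, p.Prime) (m : ℕ) (β : ℕ → ℕ → ℂ)
    {L : ℕ} (hL : smoothModulus S m ≤ L) :
    gcdForm (prodResonator S m β) L 1 = ∏ p ∈ S, locProfile p m (β p) 0 := by
  rw [gcdForm_prodResonator hS m β hL one_ne_zero]
  simp

/-! ### The Riesz–Euler local vector (W-MAG Lemmas 5.1–5.2, Prop. 5.3)

The magnification paper of the 2001 programme (`rh-w-magnification/free/y1`, §5) uses, at each prime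
`p` of a finite set `S`, the three-term local vector given by the coefficients of the polynomial
`B_p(z) = (x + y e^{iφ} z)(1 − r z)/s`, `r = p^{-1/2}`, `s = √(1 − r²)`, `x² + y² = 1`, `2xy = a ∈ [0, 1]`
("Riesz factor × Euler factor"). Its local profile is `1` at valuation `0`, `(a/2)√p·e^{iφ}` at valuation
`1`, and `0` at every valuation `≥ 2` (the Euler factor vanishes at `z = √p`), so that the product
resonator over `S` has the profile `√(n_A) (∏_{p∈A} a_p) 2^{-|A|} e^{i|A|φ}` on the integers whose `S`-part
is squarefree with support `A`, and `0` elsewhere — the Riesz–Euler design weight of W-MAG Prop. 5.3. -/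

/-- Unnormalised Riesz–Euler coefficients `(x, yE − xR, −yER)` of `(x + yE z)(1 − R z)`. [folklore] -/
def reCoeff (X Y R E : ℂ) : ℕ → ℂ
  | 0 => X
  | 1 => Y * E - X * R
  | 2 => -(Y * E * R)
  | _ => 0

/-- The polynomial weight `(U²)^{min(k+j,i)} R^{i+j}` standing for the local kernel when `R U = 1`.
[folklore] -/
def reWeight (U R : ℂ) (k i j : ℕ) : ℂ := (U ^ 2) ^ (min (k + j) i) * R ^ (i + j)

/-- The unnormalised local profile `M(k) = ∑_{i,j<3} b_i b̄_j w_k(i,j)`. [folklore] -/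
def reSum (X Y U R E Eb : ℂ) (k : ℕ) : ℂ :=
  ∑ i ∈ Finset.range 3, ∑ j ∈ Finset.range 3, reCoeff X Y R E i * reCoeff X Y R Eb j * reWeight U R k i j

/-- `M(0) = 1 − R²` (the Poisson normalisation of the Riesz–Euler factor). [folklore] -/
theorem reSum_zero (X Y U R E Eb : ℂ) (hRU : R * U = 1) (hE : E * Eb = 1) (hxy : X ^ 2 + Y ^ 2 = 1) :
    reSum X Y U R E Eb 0 = 1 - R ^ 2 := by
  simp only [reSum, Finset.sum_range_succ, Finset.sum_range_zero, zero_add, reCoeff, reWeight]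
  norm_num
  linear_combination (1 - R ^ 2) * hxy + (1 - R ^ 2) * Y ^ 2 * hE
    + ((R * U + 1) * (-(X * Y * (E + Eb) * R * (1 - R ^ 2)) + X ^ 2 * R ^ 2
        + Y ^ 2 * E * Eb * (1 + R ^ 2 * (R ^ 2 * U ^ 2 - 1)))) * hRU

/-- `M(1) = (1 − R²)·U·X·Y·E` (the first Fourier mode of `1 + a cos(θ + φ)`). [folklore] -/
theorem reSum_one (X Y U R E Eb : ℂ) (hRU : R * U = 1) :
    reSum X Y U R E Eb 1 = (1 - R ^ 2) * U * X * Y * E := by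
  simp only [reSum, Finset.sum_range_succ, Finset.sum_range_zero, zero_add, reCoeff, reWeight]
  norm_num
  linear_combination (-(R * U + 1) * (1 - R ^ 2) * (X * Y * Eb * R + X ^ 2 + Y ^ 2 * E * Eb * R ^ 2 * U ^ 2)
    + X * Y * E * (U + R ^ 2 * U * (R ^ 2 * U ^ 2 + R * U - 1))) * hRU

/-- `M(k) = 0` for `k ≥ 2` (the Euler factor `1 − R z` vanishes at `z = U`). [folklore] -/
theorem reSum_of_two_le (X Y U R E Eb : ℂ) (hRU : R * U = 1) {k : ℕ} (hk : 2 ≤ k) :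
    reSum X Y U R E Eb k = 0 := by
  have hmin : ∀ i ∈ Finset.range 3, ∀ j ∈ Finset.range 3, min (k + j) i = i := by
    intro i hi j _
    have : i < 3 := Finset.mem_range.1 hi
    exact min_eq_right (by omega)
  have : reSum X Y U R E Eb k = ∑ i ∈ Finset.range 3, ∑ j ∈ Finset.range 3,
      reCoeff X Y R E i * reCoeff X Y R Eb j * ((U ^ 2) ^ i * R ^ (i + j)) := by
    unfold reSum reWeight
    refine Finset.sum_congr rfl fun i hi => Finset.sum_congr rfl fun j hj => ?_
    rw [hmin i hi j hj]
  rw [this]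
  simp only [Finset.sum_range_succ, Finset.sum_range_zero, zero_add, reCoeff]
  norm_num
  linear_combination (-(1 - R ^ 2) * (R * U + 1) * (X * Y * Eb * R + X * Y * E * R * U ^ 2 + X ^ 2
    + Y ^ 2 * E * Eb * R ^ 2 * U ^ 2)) * hRU

/-- Conjugating the Riesz–Euler coefficients conjugates the phase only (real `X, Y, R`). [folklore] -/
theorem conj_reCoeff {X Y R : ℂ} (hX : conj X = X) (hY : conj Y = Y) (hR : conj R = R) (E : ℂ) (j : ℕ) :
    conj (reCoeff X Y R E j) = reCoeff X Y R (conj E) j := by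
  rcases j with _ | _ | _ | j <;> simp [reCoeff, hX, hY, hR]

/-- The local kernel is the polynomial weight at `U = √p`, `R = U⁻¹`. [folklore] -/
theorem locKernel_eq_reWeight (p k i j : ℕ) :
    locKernel p k i j = reWeight (Real.sqrt p : ℂ) ((Real.sqrt p : ℂ)⁻¹) k i j := by
  unfold locKernel reWeight
  have hp : ((p : ℕ) : ℂ) = (Real.sqrt p : ℂ) ^ 2 := by
    rw [← Complex.ofReal_pow, Real.sq_sqrt (Nat.cast_nonneg p), Complex.ofReal_natCast]
  rw [div_eq_mul_inv, ← inv_pow]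
  push_cast
  rw [hp]

/-- The **Riesz–Euler local vector** at the prime `p` with amplitude `a ∈ [-1, 1]` and phase `φ`
(W-MAG Lemma 5.2): the coefficients of `(x + y e^{iφ} z)(1 − z/√p)/√(1 − 1/p)` with
`x = cos(arcsin(a)/2)`, `y = sin(arcsin(a)/2)` (so `x² + y² = 1`, `2xy = a`), supported on the exponents
`0, 1, 2`. [folklore] -/
def rieszEulerVec (p : ℕ) (a φ : ℝ) (i : ℕ) : ℂ :=
  reCoeff (Real.cos (Real.arcsin a / 2)) (Real.sin (Real.arcsin a / 2)) ((Real.sqrt p)⁻¹)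
      (Complex.exp (φ * Complex.I)) i /
    (Real.sqrt (1 - ((Real.sqrt p)⁻¹) ^ 2) : ℂ)

/-- The Riesz–Euler local vector vanishes above the exponent `2`. [folklore] -/
theorem rieszEulerVec_of_three_le (p : ℕ) (a φ : ℝ) {i : ℕ} (hi : 3 ≤ i) : rieszEulerVec p a φ i = 0 := by
  unfold rieszEulerVec
  obtain ⟨j, rfl⟩ : ∃ j, i = j + 3 := ⟨i - 3, by omega⟩
  simp [reCoeff]

/-- The local profile of the Riesz–Euler vector is the normalised polynomial sum `M(k)/s²`. [folklore] -/
theorem locProfile_rieszEulerVec_eq (p : ℕ) (a φ : ℝ) (k : ℕ) :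
    locProfile p 2 (rieszEulerVec p a φ) k =
      reSum (Real.cos (Real.arcsin a / 2)) (Real.sin (Real.arcsin a / 2)) (Real.sqrt p) ((Real.sqrt p : ℂ)⁻¹)
          (Complex.exp (φ * Complex.I)) (Complex.exp (-(φ * Complex.I))) k /
        (Real.sqrt (1 - ((Real.sqrt p)⁻¹) ^ 2) : ℂ) ^ 2 := by
  unfold locProfile reSum
  rw [Finset.sum_div]
  refine Finset.sum_congr rfl fun i _ => ?_
  rw [Finset.sum_div]
  refine Finset.sum_congr rfl fun j _ => ?_
  have hconj : conj (rieszEulerVec p a φ j) =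
      reCoeff (Real.cos (Real.arcsin a / 2)) (Real.sin (Real.arcsin a / 2)) ((Real.sqrt p)⁻¹)
        (Complex.exp (-(φ * Complex.I))) j / (Real.sqrt (1 - ((Real.sqrt p)⁻¹) ^ 2) : ℂ) := by
    unfold rieszEulerVec
    rw [map_div₀, conj_reCoeff (Complex.conj_ofReal _) (Complex.conj_ofReal _)
        (by rw [map_inv₀, Complex.conj_ofReal]), Complex.conj_ofReal, ← Complex.exp_conj, map_mul,
      Complex.conj_ofReal, Complex.conj_I, mul_neg]
  rw [hconj, locKernel_eq_reWeight]
  unfold rieszEulerVec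
  push_cast
  ring

/-- The algebraic relations satisfied by the Riesz–Euler data at an integer `p ≥ 2`:
`R·U = 1`, `E·Ē = 1`, `x² + y² = 1`, and `s² = 1 − R² ≠ 0`. [folklore] -/
theorem rieszEuler_relations {p : ℕ} (hp : 2 ≤ p) (a φ : ℝ) :
    ((Real.sqrt p : ℂ))⁻¹ * (Real.sqrt p : ℂ) = 1 ∧
    Complex.exp (φ * Complex.I) * Complex.exp (-(φ * Complex.I)) = 1 ∧
    (Real.cos (Real.arcsin a / 2) : ℂ) ^ 2 + (Real.sin (Real.arcsin a / 2) : ℂ) ^ 2 = 1 ∧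
    ((Real.sqrt (1 - ((Real.sqrt p)⁻¹) ^ 2) : ℂ)) ^ 2 = 1 - ((Real.sqrt p : ℂ))⁻¹ ^ 2 ∧
    ((Real.sqrt (1 - ((Real.sqrt p)⁻¹) ^ 2) : ℂ)) ^ 2 ≠ 0 := by
  have hp0 : (0 : ℝ) < p := by exact_mod_cast (show 0 < p by omega)
  have hsq : (0 : ℝ) < Real.sqrt p := Real.sqrt_pos.2 hp0
  have hr2 : ((Real.sqrt p)⁻¹) ^ 2 = (p : ℝ)⁻¹ := by rw [inv_pow, Real.sq_sqrt hp0.le]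
  have hs2 : (0 : ℝ) < 1 - ((Real.sqrt p)⁻¹) ^ 2 := by
    rw [hr2, sub_pos, inv_lt_one_iff₀]
    right
    exact_mod_cast (show 1 < p by omega)
  have hs : ((Real.sqrt (1 - ((Real.sqrt p)⁻¹) ^ 2) : ℂ)) ^ 2 = 1 - ((Real.sqrt p : ℂ))⁻¹ ^ 2 := by
    rw [← Complex.ofReal_pow, Real.sq_sqrt hs2.le]
    push_cast
    ring
  refine ⟨inv_mul_cancel₀ (by exact_mod_cast hsq.ne'), ?_, ?_, hs, ?_⟩
  · rw [← Complex.exp_add, add_neg_cancel, Complex.exp_zero]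
  · rw [← Complex.ofReal_pow, ← Complex.ofReal_pow, ← Complex.ofReal_add, Real.cos_sq_add_sin_sq]
    simp
  · rw [← Complex.ofReal_pow, Real.sq_sqrt hs2.le]
    exact_mod_cast hs2.ne'

/-- **W-MAG Lemma 5.2 / Prop. 5.3 (local form), valuation `0`**: for an integer `p ≥ 2`, any `a`, `φ`,
the local gcd-profile of the Riesz–Euler vector at valuation `0` equals `1`. [folklore] -/
theorem locProfile_rieszEulerVec_zero {p : ℕ} (hp : 2 ≤ p) (a φ : ℝ) :
    locProfile p 2 (rieszEulerVec p a φ) 0 = 1 := by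
  obtain ⟨hRU, hE, hxy, hs, hs0⟩ := rieszEuler_relations hp a φ
  rw [locProfile_rieszEulerVec_eq, reSum_zero _ _ _ _ _ _ hRU hE hxy, ← hs]
  exact div_self hs0

/-- **W-MAG Lemma 5.2 / Prop. 5.3 (local form), valuation `1`**: for an integer `p ≥ 2`, `-1 ≤ a ≤ 1` and
any `φ`, the local gcd-profile of the Riesz–Euler vector at valuation `1` equals `(a/2)·√p·e^{iφ}`.
[folklore] -/
theorem locProfile_rieszEulerVec_one {p : ℕ} (hp : 2 ≤ p) {a : ℝ} (ha₁ : -1 ≤ a) (ha₂ : a ≤ 1) (φ : ℝ) :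
    locProfile p 2 (rieszEulerVec p a φ) 1 = ((a / 2 * Real.sqrt p : ℝ) : ℂ) * Complex.exp (φ * Complex.I) := by
  obtain ⟨hRU, _, _, hs, hs0⟩ := rieszEuler_relations hp a φ
  rw [locProfile_rieszEulerVec_eq, reSum_one _ _ _ _ _ _ hRU, ← hs]
  have hxy : (Real.cos (Real.arcsin a / 2) : ℂ) * (Real.sin (Real.arcsin a / 2) : ℂ) = ((a / 2 : ℝ) : ℂ) := by
    rw [← Complex.ofReal_mul]
    congr 1
    have h := Real.sin_two_mul (Real.arcsin a / 2)
    rw [mul_div_cancel₀ _ (two_ne_zero), Real.sin_arcsin ha₁ ha₂] at h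
    linarith
  rw [show ((Real.sqrt (1 - ((Real.sqrt p)⁻¹) ^ 2) : ℂ)) ^ 2 * (Real.sqrt p : ℂ) *
      (Real.cos (Real.arcsin a / 2) : ℂ) * (Real.sin (Real.arcsin a / 2) : ℂ) * Complex.exp (φ * Complex.I) =
      ((Real.sqrt (1 - ((Real.sqrt p)⁻¹) ^ 2) : ℂ)) ^ 2 * ((Real.sqrt p : ℂ) *
      ((Real.cos (Real.arcsin a / 2) : ℂ) * (Real.sin (Real.arcsin a / 2) : ℂ)) * Complex.exp (φ * Complex.I))
      by ring, mul_div_cancel_left₀ _ hs0, hxy]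
  push_cast
  ring

/-- **W-MAG Lemma 5.2 / Prop. 5.3 (local form), valuation `≥ 2`**: the local gcd-profile of the Riesz–Euler
vector vanishes at every valuation `k ≥ 2` (the Euler factor kills the higher levels). [folklore] -/
theorem locProfile_rieszEulerVec_of_two_le {p : ℕ} (hp : 2 ≤ p) (a φ : ℝ) {k : ℕ} (hk : 2 ≤ k) :
    locProfile p 2 (rieszEulerVec p a φ) k = 0 := by
  obtain ⟨hRU, _, _, _, _⟩ := rieszEuler_relations hp a φ
  rw [locProfile_rieszEulerVec_eq, reSum_of_two_le _ _ _ _ _ _ hRU hk, zero_div]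

/-! ### The Riesz–Euler product resonator and its profile (W-MAG Prop. 5.3) -/

/-- The **Riesz–Euler product resonator** over a finite set `S` of primes with amplitudes `a : S → [-1,1]`
and a common phase `φ` (W-MAG Prop. 5.3): the product of the Riesz–Euler local vectors, supported on the
divisors of `∏_{p∈S} p²`. [folklore] -/
def rieszEulerResonator (S : Finset ℕ) (a : ℕ → ℝ) (φ : ℝ) : ℕ → ℂ :=
  prodResonator S 2 (fun p => rieszEulerVec p (a p) φ)

/-- The Riesz–Euler resonator vanishes above `∏_{p∈S} p²`. [folklore] -/
theorem rieszEulerResonator_eq_zero_of_lt {S : Finset ℕ} (a : ℕ → ℝ) (φ : ℝ) {ℓ : ℕ}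
    (h : smoothModulus S 2 < ℓ) : rieszEulerResonator S a φ ℓ = 0 :=
  prodResonator_eq_zero_of_lt _ h

/-- `√(∏ x) = ∏ √x` for nonnegative factors. [folklore] -/
theorem sqrt_prod_eq_prod_sqrt {ι : Type*} (s : Finset ι) (f : ι → ℝ) (hf : ∀ i ∈ s, 0 ≤ f i) :
    Real.sqrt (∏ i ∈ s, f i) = ∏ i ∈ s, Real.sqrt (f i) := by
  classical
  induction s using Finset.induction_on with
  | empty => simp
  | @insert x s hx ih =>
    rw [Finset.prod_insert hx, Finset.prod_insert hx,
      Real.sqrt_mul (hf x (Finset.mem_insert_self x s)), ih (fun i hi => hf i (Finset.mem_insert_of_mem hi))]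

/-- **W-MAG Prop. 5.3, the profile at `n = 1`**: `Φ_α(1) = 1` for the Riesz–Euler resonator
(`𝒩(α) = 1`). [folklore] -/
theorem gcdForm_rieszEuler_one {S : Finset ℕ} (hS : ∀ p ∈ S, p.Prime) (a : ℕ → ℝ) (φ : ℝ) {L : ℕ}
    (hL : smoothModulus S 2 ≤ L) : gcdForm (rieszEulerResonator S a φ) L 1 = 1 := by
  unfold rieszEulerResonator
  rw [gcdForm_prodResonator_one hS 2 _ hL]
  exact Finset.prod_eq_one fun p hp => locProfile_rieszEulerVec_zero (hS p hp).two_le _ _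

/-- **W-MAG Prop. 5.3, vanishing on non-squarefree `S`-parts**: if `p² ∣ n` for some `p ∈ S` then
`Φ_α(n) = 0`. [folklore] -/
theorem gcdForm_rieszEuler_of_sq_dvd {S : Finset ℕ} (hS : ∀ p ∈ S, p.Prime) (a : ℕ → ℝ) (φ : ℝ) {L : ℕ}
    (hL : smoothModulus S 2 ≤ L) {n : ℕ} (hn : n ≠ 0) {p : ℕ} (hp : p ∈ S) (hpn : p ^ 2 ∣ n) :
    gcdForm (rieszEulerResonator S a φ) L n = 0 := by
  unfold rieszEulerResonator
  rw [gcdForm_prodResonator hS 2 _ hL hn]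
  refine Finset.prod_eq_zero hp ?_
  exact locProfile_rieszEulerVec_of_two_le (hS p hp).two_le _ _
    (((hS p hp).pow_dvd_iff_le_factorization hn).1 hpn)

/-- **W-MAG Prop. 5.3, the profile on squarefree `S`-parts**: if `p² ∤ n` for all `p ∈ S` (`n ≠ 0`) then
`Φ_α(n) = (∏_{p∈A} (a_p/2)√p) · e^{i|A|φ}` with `A = {p ∈ S : p ∣ n}`. [folklore] -/
theorem gcdForm_rieszEuler_of_squarefree {S : Finset ℕ} (hS : ∀ p ∈ S, p.Prime) {a : ℕ → ℝ}
    (ha : ∀ p ∈ S, -1 ≤ a p ∧ a p ≤ 1) (φ : ℝ) {L : ℕ} (hL : smoothModulus S 2 ≤ L) {n : ℕ} (hn : n ≠ 0)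
    (hsq : ∀ p ∈ S, ¬ p ^ 2 ∣ n) :
    gcdForm (rieszEulerResonator S a φ) L n =
      ((∏ p ∈ S.filter (· ∣ n), (a p / 2 * Real.sqrt p) : ℝ) : ℂ) *
        Complex.exp (φ * Complex.I) ^ (S.filter (· ∣ n)).card := by
  unfold rieszEulerResonator
  rw [gcdForm_prodResonator hS 2 _ hL hn, ← Finset.prod_filter_mul_prod_filter_not S (· ∣ n)]
  have h1 : ∏ p ∈ S.filter (· ∣ n), locProfile p 2 (rieszEulerVec p (a p) φ) (n.factorization p) =
      ∏ p ∈ S.filter (· ∣ n), (((a p / 2 * Real.sqrt p : ℝ) : ℂ) * Complex.exp (φ * Complex.I)) := by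
    refine Finset.prod_congr rfl fun p hp => ?_
    obtain ⟨hpS, hpn⟩ := Finset.mem_filter.1 hp
    have hv : n.factorization p = 1 := by
      have h1 : 1 ≤ n.factorization p := ((hS p hpS).dvd_iff_one_le_factorization hn).1 hpn
      have h2 : ¬ 2 ≤ n.factorization p := fun h =>
        hsq p hpS (((hS p hpS).pow_dvd_iff_le_factorization hn).2 h)
      omega
    rw [hv]
    exact locProfile_rieszEulerVec_one (hS p hpS).two_le (ha p hpS).1 (ha p hpS).2 φ
  have h2 : ∏ p ∈ S.filter (fun p => ¬ p ∣ n), locProfile p 2 (rieszEulerVec p (a p) φ) (n.factorization p) = 1 := by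
    refine Finset.prod_eq_one fun p hp => ?_
    obtain ⟨hpS, hpn⟩ := Finset.mem_filter.1 hp
    rw [Nat.factorization_eq_zero_of_not_dvd hpn]
    exact locProfile_rieszEulerVec_zero (hS p hpS).two_le _ _
  rw [h1, h2, mul_one, Finset.prod_mul_distrib, Finset.prod_const]
  push_cast
  rfl

/-- **W-MAG Prop. 5.3 (the Riesz–Euler design weight)**: for a finite set `S` of primes, amplitudes
`a_p ∈ [-1, 1]`, a phase `φ`, any truncation `L ≥ ∏_{p∈S} p²` and any `n ≠ 0`, the REAL PART of the gcd form
of the Riesz–Euler resonator is `√(n_A) (∏_{p∈A} a_p) 2^{-|A|} cos(|A| φ)` (`A = {p ∈ S : p ∣ n}`,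
`n_A = ∏_{p∈A} p`) if the `S`-part of `n` is squarefree, and `0` otherwise — literally the expression used
as the design weight `Φ_{S,a,φ}(n)` in the crux line `ConeMagnification/Lines/Sketch.lean`
(`stub_designOfTypes`, conclusion AX-C). [folklore] -/
theorem re_gcdForm_rieszEuler {S : Finset ℕ} (hS : ∀ p ∈ S, p.Prime) {a : ℕ → ℝ}
    (ha : ∀ p ∈ S, -1 ≤ a p ∧ a p ≤ 1) (φ : ℝ) {L : ℕ} (hL : smoothModulus S 2 ≤ L) {n : ℕ} (hn : n ≠ 0) :
    (gcdForm (rieszEulerResonator S a φ) L n).re =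
      if ∀ p ∈ S, ¬ (p ^ 2 ∣ n) then
        Real.sqrt (∏ p ∈ S.filter (· ∣ n), (p : ℝ)) * (∏ p ∈ S.filter (· ∣ n), a p) *
          (1 / 2) ^ (S.filter (· ∣ n)).card * Real.cos (((S.filter (· ∣ n)).card : ℝ) * φ)
      else 0 := by
  split_ifs with hsq
  · rw [gcdForm_rieszEuler_of_squarefree hS ha φ hL hn hsq, ← Complex.exp_nat_mul,
      show ((S.filter (· ∣ n)).card : ℂ) * (φ * Complex.I) = (((S.filter (· ∣ n)).card * φ : ℝ) : ℂ) * Complex.I by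
        push_cast; ring,
      Complex.re_ofReal_mul, Complex.exp_ofReal_mul_I_re]
    congr 1
    rw [Finset.prod_mul_distrib, Finset.prod_div_distrib, Finset.prod_const,
      sqrt_prod_eq_prod_sqrt _ _ (fun p _ => Nat.cast_nonneg p), one_div, inv_pow, div_eq_mul_inv]
    ring
  · push Not at hsq
    obtain ⟨p, hp, hpn⟩ := hsq
    rw [gcdForm_rieszEuler_of_sq_dvd hS a φ hL hn hp hpn, Complex.zero_re]

end GcdForm

end Literature.NumberTheory.LFunctions

end
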